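import Literature.RingTheory.CohomologyAnnihilator.NoetherDifferent
import Literature.RingTheory.CohomologyAnnihilator.StrongGenerator
import HarnessLib

/-!
# The noether different produces cohomology annihilators (Iyengar–Takahashi, Lemma 3.3 & Prop. 3.4)

Topic: `Literature/RingTheory/CohomologyAnnihilator`. For a commutative noetherian ring `A` and a
commutative `A`-algebra `B` that is finitely generated as an `A`-MODULE (a "noether
`A`-algebra"), [IyengarTakahashi2014, Proposition 3.4] says: if `d = gldim A` is finite and
`I = ann_A Ext¹_A(B, Ω_A B)`, then `Iᵈ · 𝔑(B/A) ⊆ caⁿ(B)` for `n ≥ d + 1`. We PROVE it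
(commutative case) in the form

* `noetherDifferent_mul_pow_le_cohomologyAnnihilatorOfDegree` — if `caᵈ⁺¹(A) = A`
  (`gldim A ≤ d` on finitely generated modules, [IyengarTakahashi2014, Example 2.5]) then
  `𝔑(B/A) · I'ᵈ B ⊆ caᵈ⁺¹(B)` (`⊆ caⁿ(B)` for `n ≥ d + 1` by monotonicity), where
  `I' = ann_A Ext^{≥1}_A(B, mod A) = extAnnihilatorFrom B_A 1 ⊇ I` (by Lemma 2.14, so this is the
  printed statement with a possibly larger ideal),

via the special case `J = A` of

* `pow_extAnnihilatorFrom_le_annihilator_ext_restrictScalars` — **Lemma 3.3** with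
  `ann_A Extⁿ_A(mod B, mod B) = A` (`n = d + 1`): for `i + j = d + 1`, `j ≥ 1`, and an `i`-th
  syzygy `K = Ωⁱ_B M` over `B`, `I'ⁱ ⊆ ann_A Extʲ_A(K, N)` — induction along
  `0 → Ωⁱ⁺¹M → P → ΩⁱM → 0` restricted to `A`, the left `Ext` being killed by `I'` because a
  finitely generated projective `B`-module is a direct summand of `Bʳ` also over `A`,

and **Lemma 3.2** (`NoetherDifferent.lean`) plus dimension shifting over `B`
(`StrongGenerator.lean`) and Remark 2.3 (`Basic.lean`).

## References

* S. B. Iyengar, R. Takahashi, *Annihilation of cohomology and strong generation of module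
  categories*, IMRN 2016; arXiv:1404.1476 — Lemma 3.3, Proposition 3.4. [`IyengarTakahashi2014`]
-/

noncomputable section

open CategoryTheory CategoryTheory.Abelian CategoryTheory.Limits

universe u

namespace Literature.RingTheory.CohomologyAnnihilator

/-! ## Finite decompositions of the identity and annihilation of `Ext` -/

section Decomposition

variable {A : Type u} [CommRing A]

/-- If `𝟙_Z = Σⱼ πⱼ ≫ ιⱼ` factors through `G` (finitely many terms) and `a` kills `Extⁿ(G, N)`, then
`a` kills `Extⁿ(Z, N)` (additivity of `Ext`). [folklore] -/
theorem ext_smul_eq_zero_of_sum_comp_eq_id {Z G N : ModuleCat.{u} A} {ι : Type} [Fintype ι]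
    (π : ι → (Z ⟶ G)) (ι' : ι → (G ⟶ Z)) (h : ∑ j, π j ≫ ι' j = 𝟙 Z) {n : ℕ} (a : A)
    (hG : ∀ e : Ext.{u} G N n, a • e = 0) (e : Ext.{u} Z N n) : a • e = 0 := by
  have he : e = ∑ j, (Ext.mk₀ (π j)).comp ((Ext.mk₀ (ι' j)).comp e (zero_add n)) (zero_add n) := by
    simp only [Ext.mk₀_comp_mk₀_assoc]
    rw [← Ext.sum_comp, ← Ext.mk₀_sum, h, Ext.mk₀_id_comp]
  rw [he, Finset.smul_sum]
  refine Finset.sum_eq_zero fun j _ => ?_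
  rw [← Ext.comp_smul, hG, Ext.comp_zero]

end Decomposition

section NoetherAlgebra

variable {A : Type u} [CommRing A] {B : Type u} [CommRing B] [Algebra A B]

/-- A finitely generated projective `B`-module is a direct summand of some `Bʳ`: there are
`αⱼ : P → B`, `βⱼ : B → P` (`j < r`) with `Σⱼ βⱼ αⱼ = 𝟙_P`. [folklore] -/
theorem exists_sum_comp_eq_id_of_projective (P : ModuleCat.{u} B) [Module.Finite B P]
    [Module.Projective B P] :
    ∃ (r : ℕ) (α : Fin r → (P ⟶ ModuleCat.of B B)) (β : Fin r → (ModuleCat.of B B ⟶ P)),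
      ∑ j, α j ≫ β j = 𝟙 P := by
  obtain ⟨r, f, hf⟩ := Module.Finite.exists_fin' B P
  obtain ⟨g, hg⟩ := f.exists_rightInverse_of_surjective (LinearMap.range_eq_top.2 hf)
  refine ⟨r, fun j => ModuleCat.ofHom ((LinearMap.proj j).comp g),
    fun j => ModuleCat.ofHom (f.comp (LinearMap.single B (fun _ => B) j)), ?_⟩
  apply ModuleCat.hom_ext
  refine LinearMap.ext fun x => ?_
  simp only [ModuleCat.hom_sum, ModuleCat.hom_comp, ModuleCat.hom_ofHom, LinearMap.coe_sum,
    Finset.sum_apply, LinearMap.coe_comp, Function.comp_apply, LinearMap.coe_proj,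
    Function.eval, LinearMap.coe_single, ModuleCat.hom_id, LinearMap.id_coe, id_eq]
  rw [← map_sum, Finset.univ_sum_single]
  exact LinearMap.congr_fun hg x

variable (A B) in
/-- The restriction-of-scalars functor `mod B → mod A` along the structure map. [folklore] -/
abbrev restrictScalarsFunctor : ModuleCat.{u} B ⥤ ModuleCat.{u} A :=
  ModuleCat.restrictScalars.{u} (algebraMap A B)

/-- A finitely generated `B`-module is finitely generated over `A` when `B` is module-finite over
`A`. [folklore] -/
theorem finite_restrictScalars [Module.Finite A B] (M : ModuleCat.{u} B) [Module.Finite B M] :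
    Module.Finite A ((restrictScalarsFunctor A B).obj M) := by
  haveI : IsScalarTower A B ((restrictScalarsFunctor A B).obj M) :=
    IsScalarTower.of_algebraMap_smul fun _ _ => rfl
  haveI : Module.Finite B ((restrictScalarsFunctor A B).obj M) := ‹Module.Finite B M›
  exact Module.Finite.trans B _

/-- The ideal `I' = ann_A Ext^{≥1}_A(B, mod A)` of [IyengarTakahashi2014, Prop. 3.4] (there
`I = ann_A Ext¹_A(Λ, Ω_A Λ)`, which equals `ann_A Ext^{≥1}_A(Λ, Mod A)` by Lemma 2.14) kills
`Extʲ_A(P, N)` for `j ≥ 1`, `N` finitely generated, and `P` a finitely generated projective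
`B`-module (a direct summand of `Bʳ` over `B`, hence over `A`).
[cite: IyengarTakahashi2014, Lemma 3.3 (proof)] -/
theorem ext_restrictScalars_smul_eq_zero_of_projective (P : ModuleCat.{u} B) [Module.Finite B P]
    [Module.Projective B P] {a : A}
    (ha : a ∈ extAnnihilatorFrom ((restrictScalarsFunctor A B).obj (ModuleCat.of B B)) 1)
    (N : ModuleCat.{u} A) [Module.Finite A N] {j : ℕ} (hj : 1 ≤ j)
    (e : Ext.{u} ((restrictScalarsFunctor A B).obj P) N j) : a • e = 0 := by
  obtain ⟨r, α, β, h⟩ := exists_sum_comp_eq_id_of_projective P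
  have h' : ∑ j, (restrictScalarsFunctor A B).map (α j) ≫ (restrictScalarsFunctor A B).map (β j) =
      𝟙 ((restrictScalarsFunctor A B).obj P) := by
    rw [← (restrictScalarsFunctor A B).map_id, ← h, Functor.map_sum]
    simp only [Functor.map_comp]
  rw [mem_extAnnihilatorFrom_iff] at ha
  exact ext_smul_eq_zero_of_sum_comp_eq_id _ _ h' a (ha j hj N ‹_›) e

/-- **Lemma 3.3** (commutative case, with `ann_A Extᵈ⁺¹_A(mod B, mod B) = A`): let `B` be
module-finite over the noetherian ring `A` with `caᵈ⁺¹(A) = A`, and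
`I' = ann_A Ext^{≥1}_A(B, mod A)`. For finitely generated `B`-modules `M`, `N`, an `i`-th syzygy
`K = Ωⁱ_B M` over `B`, and `i + j = d + 1` with `j ≥ 1`: `I'ⁱ ⊆ ann_A Extʲ_A(K, N)`.
Induction on `i` along `0 → Ωⁱ⁺¹M → P → ΩⁱM → 0` (restricted to `A`, still exact): in
`Extʲ_A(P, N) → Extʲ_A(Ωⁱ⁺¹M, N) → Extʲ⁺¹_A(ΩⁱM, N)` the right-hand module is killed by `I'ⁱ`
(induction) and the left-hand one by `I'` (`P` is a summand of `Bʳ`), so the middle one is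
killed by `I'ⁱ⁺¹`. [cite: IyengarTakahashi2014, Lemma 3.3] -/
theorem pow_extAnnihilatorFrom_le_annihilator_ext_restrictScalars [IsNoetherianRing A]
    [Module.Finite A B] {d : ℕ} (hvan : cohomologyAnnihilatorOfDegree A (d + 1) = ⊤)
    (M N : ModuleCat.{u} B) [Module.Finite B M] [Module.Finite B N] :
    ∀ (i : ℕ) {j : ℕ}, i + j = d + 1 → 1 ≤ j → ∀ {K : ModuleCat.{u} B}, IsSyzygy i M K →
      extAnnihilatorFrom ((restrictScalarsFunctor A B).obj (ModuleCat.of B B)) 1 ^ i ≤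
        Module.annihilator A
          (Ext.{u} ((restrictScalarsFunctor A B).obj K) ((restrictScalarsFunctor A B).obj N) j) := by
  set R := restrictScalarsFunctor A B
  haveI : Module.Finite A (R.obj N) := finite_restrictScalars N
  intro i
  induction i with
  | zero =>
    intro j hij _ K hK a _
    obtain ⟨e⟩ := hK
    haveI : Module.Finite B K :=
      Module.Finite.equiv (M := M) e.symm.toLinearEquiv
    haveI : Module.Finite A (R.obj K) := finite_restrictScalars K
    rw [Module.mem_annihilator]
    intro x
    rw [zero_add] at hij
    subst hij
    rw [cohomologyAnnihilatorOfDegree_eq_top_iff.mp hvan (d + 1) le_rfl (R.obj K) (R.obj N) ‹_› ‹_› x,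
      smul_zero]
  | succ i ih =>
    intro j hij hj K hK
    obtain ⟨K', P, hK', hPfin, hP, f, g, w, hS⟩ := hK
    haveI : Module.Finite B P := hPfin
    haveI : Projective P := hP
    -- the restricted sequence, with its terms spelled `R.obj _`
    let SA : ShortComplex (ModuleCat.{u} A) :=
      ShortComplex.mk (R.map f) (R.map g) (by rw [← Functor.map_comp, w, Functor.map_zero])
    have hSA : SA.ShortExact := hS.map_of_exact R
    have ih' := ih (j := j + 1) (by omega) (by omega) hK'
    rw [pow_succ, Ideal.mul_le]
    intro c hc b hb
    rw [Module.mem_annihilator]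
    intro x
    -- `δ (c x) = c δ x = 0`, so `c x` comes from `Extʲ_A(P, N)`, which `b` kills
    have hδ : hSA.extClass.comp (c • x) (add_comm 1 j) = 0 := by
      rw [Ext.comp_smul]
      exact Module.mem_annihilator.mp (ih' hc) _
    obtain ⟨y, hy⟩ := Ext.contravariant_sequence_exact₁ hSA _ (c • x) (add_comm 1 j) hδ
    rw [mul_comm, mul_smul, ← hy, ← Ext.comp_smul,
      ext_restrictScalars_smul_eq_zero_of_projective P hb (R.obj N) hj y, Ext.comp_zero]

/-- Dimension shifting over `B`, surjective direction, one degree at a time: if `z` kills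
`Extʲ_B(Ωˢ M, N)` for all finitely generated `N` then `z` kills `Extʲ⁺ˢ_B(M, N)` for all such
`N`. [cite: IyengarTakahashi2014, Remark 2.3] -/
theorem ext_smul_eq_zero_of_isSyzygy_of_forall {C : Type u} [CommRing C] :
    ∀ (s : ℕ) {M K : ModuleCat.{u} C}, IsSyzygy s M K → ∀ {j : ℕ} {z : C},
      (∀ N : ModuleCat.{u} C, Module.Finite C N → ∀ e : Ext.{u} K N j, z • e = 0) →
        ∀ N : ModuleCat.{u} C, Module.Finite C N → ∀ e : Ext.{u} M N (j + s), z • e = 0 := by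
  intro s
  induction s with
  | zero =>
    intro M K hK j z hz N hN e
    obtain ⟨i⟩ := hK
    exact ext_smul_eq_zero_of_iso i (Iso.refl N) z (hz N hN) e
  | succ s ih =>
    intro M K hK j z hz N hN e
    obtain ⟨K', P, hK', _, hP, f, g, w, hS⟩ := hK
    haveI : Projective (ShortComplex.mk f g w).X₂ := hP
    have hK'z : ∀ N : ModuleCat.{u} C, Module.Finite C N →
        ∀ e : Ext.{u} K' N (j + 1), z • e = 0 := by
      intro N hN e
      obtain ⟨e', rfl⟩ := precomp_extClass_surjective_of_projective_X₂ N hS j e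
      change z • hS.extClass.comp e' (add_comm 1 j) = 0
      rw [← Ext.comp_smul, hz N hN e', Ext.comp_zero]
    have := ih hK' hK'z N hN
    rw [show j + 1 + s = j + (s + 1) by omega] at this
    exact this e

/-- **Proposition 3.4** (commutative case), elementwise: let `B` be module-finite over the
noetherian ring `A` with `caᵈ⁺¹(A) = A` ("`gldim A = d` finite"), let
`I' = ann_A Ext^{≥1}_A(B, mod A)`, `x ∈ 𝔑(B/A)` and `c ∈ I'ᵈ`. Then `x · c ∈ caᵈ⁺¹(B)`:
for finitely generated `M`, `N`, Lemma 3.3 gives that `c` kills `Ext¹_A(Ωᵈ_B M, N)`, Lemma 3.2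
that `x c` kills `Ext¹_B(Ωᵈ_B M, N)`, hence `Extᵈ⁺¹_B(M, N)` (dimension shifting), and Remark 2.3
concludes. [cite: IyengarTakahashi2014, Prop. 3.4] -/
theorem noetherDifferent_mul_mem_cohomologyAnnihilatorOfDegree [IsNoetherianRing A]
    [Module.Finite A B] {d : ℕ} (hvan : cohomologyAnnihilatorOfDegree A (d + 1) = ⊤) {x : B}
    (hx : x ∈ noetherDifferent A B) {c : A}
    (hc : c ∈ extAnnihilatorFrom ((restrictScalarsFunctor A B).obj (ModuleCat.of B B)) 1 ^ d) :
    x * algebraMap A B c ∈ cohomologyAnnihilatorOfDegree B (d + 1) := by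
  haveI : IsNoetherianRing B := isNoetherian_of_tower A inferInstance
  rw [mem_cohomologyAnnihilatorOfDegree_iff_of_isNoetherianRing]
  intro M N hM hN e
  obtain ⟨K, _, hK⟩ := exists_isSyzygy M d
  have h1 : ∀ N' : ModuleCat.{u} B, Module.Finite B N' →
      ∀ e' : Ext.{u} K N' 1, (x * algebraMap A B c) • e' = 0 := by
    intro N' hN' e'
    refine noetherDifferent_mul_smul_ext_eq_zero K N' hx (fun e'' => ?_) e'
    exact Module.mem_annihilator.mp
      (pow_extAnnihilatorFrom_le_annihilator_ext_restrictScalars hvan M N' d (j := 1) rfl le_rfl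
        hK hc) e''
  have := ext_smul_eq_zero_of_isSyzygy_of_forall d hK h1 N hN
  rw [add_comm] at this
  exact this e

/-- **Proposition 3.4** (commutative case), ideal form: with `B` module-finite over the
noetherian ring `A`, `caᵈ⁺¹(A) = A` and `I' = ann_A Ext^{≥1}_A(B, mod A)`:
`𝔑(B/A) · (I'ᵈ B) ⊆ caᵈ⁺¹(B)` (and hence `⊆ caⁿ(B)` for all `n ≥ d + 1`,
`cohomologyAnnihilatorOfDegree_mono`). [cite: IyengarTakahashi2014, Prop. 3.4] -/
theorem noetherDifferent_mul_pow_le_cohomologyAnnihilatorOfDegree [IsNoetherianRing A]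
    [Module.Finite A B] {d : ℕ} (hvan : cohomologyAnnihilatorOfDegree A (d + 1) = ⊤) :
    noetherDifferent A B *
        (extAnnihilatorFrom ((restrictScalarsFunctor A B).obj (ModuleCat.of B B)) 1 ^ d).map
          (algebraMap A B) ≤
      cohomologyAnnihilatorOfDegree B (d + 1) := by
  rw [Ideal.mul_le]
  intro x hx y hy
  refine Submodule.span_induction (p := fun y _ => x * y ∈ cohomologyAnnihilatorOfDegree B (d + 1))
    ?_ ?_ ?_ ?_ hy
  · rintro _ ⟨c, hc, rfl⟩
    exact noetherDifferent_mul_mem_cohomologyAnnihilatorOfDegree hvan hx hc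
  · rw [mul_zero]; exact Ideal.zero_mem _
  · intro y z _ _ hy hz
    rw [mul_add]
    exact Ideal.add_mem _ hy hz
  · intro b y _ hy
    rw [smul_eq_mul, mul_left_comm]
    exact Ideal.mul_mem_left _ b hy

end NoetherAlgebra

end Literature.RingTheory.CohomologyAnnihilator

end
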